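import Literature.NumberTheory.LFunctions.Zhang2022.DHMenuConsistentPrimesKit
import Literature.NumberTheory.LFunctions.Zhang2022.DHMenuConsistentPrimesPsi
import Literature.NumberTheory.LFunctions.Zhang2022.DHMenuConsistentWorld
import Mathlib.Analysis.SpecialFunctions.Integrals.Basic
import Mathlib.Analysis.Convex.SpecificFunctions.Basic

/-!
# Zhang (2022) / KILL(B-dh) §E target E-18b: `DH.menuConsistentPrimes_holds : MenuConsistentPrimes` — the remaining
# θ-rows P2–P5 (Thorner–Zaman Theorem 1 / Corollary 5, regular and exceptional cases) on `(world D χ, primeWorld D χ)`,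
# and the ASSEMBLY

Cell `landau-siegel`, sub-cell E, stub S-E-bd2-2 (ls-Bdh-typer-2 g2; split of record ls-barrier-plan g1 21:45:27Z /
amendment 21:53:22Z: ψ-side = ls-Bdh-typer-1 g2 `DHMenuConsistentPrimesPsi` p470447 (`world_rowP1`, `world_psi_nonneg_mono`);
kit + rows S5 (i)(ii) + P6 = ls-barrier-p4 g2 `DHMenuConsistentPrimesKit` p472204 (`primeWorld_theta_closed`,
`world_rowS5_additive`, `world_rowS5_theta`, `world_rowP6`, …); rows P2–P5 + assembly = this file).
**WHAT THIS IS NOT: no claim about Landau–Siegel zeros, about Theorems 1–2 of arXiv:2211.02515, about primes in arithmetic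
progressions, or about the truth of any analytic prime row (Thorner–Zaman's Theorem 1 / Corollary 5, BMOR's Lemma 6.12,
Xylouris's Linnik constant are NOT proved here); `MenuConsistentPrimes` (DHChainBarrierPrimes.lean :147, p464158) is the
internal consistency of the prime side of Zhang's deduced menu in the model world `W(D, χ)` with the Siegel main-term datum
`θ_W(x;q,a,h) = (1/φ(q))∫_{max(x−h,1)}^{max(x,1)} (1 − s(q,a) t^{β₁−1}) dt` — E-18b's premise object (director 19:31:07Z term (i),
REF-B3 countersign 20:22:17Z, ls-lead 20:23:52Z), not a statement about `¬(A)` and not about any `L`-function.**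
«The programme SEARCHES and TYPES; no claim about Landau–Siegel zeros, Theorems 1–2 of arXiv:2211.02515 or a repaired
Margin232 until a kernel theorem says so.»

## What is proved (`w := world D χ`, `p := primeWorld D χ`, `β₁ := betaExc D`, `δ := 1 − β₁ = (2/3)(log D)^{−2022}`,
## `s := siegelSign D χ q a` with `|s| ≤ 1`, `χ` primitive quadratic `≠ χ₀`, `log D ≥ 43 250`)

* §0–§1 bookkeeping: `0.99 < β₁`, `1/β₁ ≤ 1.02`, `−1 < β₁ − 1 < 0`; `|1 − s t^{β₁−1}| ≤ 1 + t^{β₁−1}` (`t ≥ 0`); the integrand is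
  interval-integrable on EVERY interval (`intervalIntegrable_rpow'`, exponent `> −1` — the kit's version needs positive
  endpoints, row P3 integrates from `x − h ≥ 0`); closed forms `integral_integrand` / `integral_one_add_rpow` on arbitrary
  intervals; `siegelSign_of_dvd` (`s = Re (changeLevel χ)(a)` on `D ∣ q`).
* §2 the exceptional pair over `W`: `exceptionalPair_world` (an exceptional pair `(χ₁, β)` at level `q ≥ 2` IS the induced
  slot with `β = β₁`, by `real_zero_gt_half`), `isQuadratic_changeLevel`, `betaExc_lt_of_no_exceptionalPair` («no
  exceptional pair at `q`», `D ∣ q` ⇒ `β₁ < 1 − 1/(50 log q)`), `log_le_errDenom` (`errDenom ≥ log q` for `4 ≤ h ≤ x`), the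
  decay bookkeeping `exp_logq_le_exp_errDenom`, `rpow_le_decay` (`x^{β−1} ≤ e^{−(1/50) log x/log q}` once
  `β ≤ 1 − 1/(50 log q)`), `one_le_mul_decay` (`1 ≤ y·e^{−(1/50) log x/log q}` once `y ≥ x^p`, `p ≥ 1/25`), and the one estimate
  with content, **`rpow_sub_rpow_le_four_mul`**: `x^β − m^β ≤ 4 h x^{β−1}` for `1 ≤ m ≤ x`, `x − m ≤ h`, `0 < β ≤ 1` (Bernoulli
  `rpow_one_add_le_one_add_mul_self` when `x ≤ 2m`; `x^β = x·x^{β−1} < 2h x^{β−1}` when `x > 2m`).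
* §3 the rows, each with the field's statement VERBATIM for `(w, p)`: **`world_rowP2`** (TZ Thm 1 regular; witnesses
  `c = 1/50`, `K = 6`: `|θ_W − h/φ| ≤ (1 + 4·1.02·h x^{−δ}·[D ∣ q])/φ`, `1 ≤ h e^{−(1/50)log x/log q}`, and
  `x^{−δ} ≤ e^{−(1/50)log x/log q}` because «no exceptional pair» forces `δ > 1/(50 log q)` on `D ∣ q`); **`world_rowP3`** (TZ Thm 1
  exceptional; `c = 1/50`, `K = 3`: the pair is `(changeLevel χ, β₁)`, `s = Re χ₁(a)`, so `θ_W = λh/φ` exactly when `x − h ≥ 1`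
  and otherwise they differ by `|∫_{x−h}^{1}(1 − s t^{β₁−1})dt|/φ ≤ 1 + 1/β₁ ≤ 2.02 ≤ 3 ≤ K·(λh/φ)·e^{…}` as `λh/φ ≥ x^{71/75+ε}`);
  **`world_rowP4`** / **`world_rowP5`** (TZ Cor 5, `h = x`; `c = 1/50`, `K = 3`).
* §4 **`menuConsistentPrimes_holds : MenuConsistentPrimes`** — the `PrimeMenu` constructor: `rowP1 := world_rowP1 hL hquad`
  (Psi), `rowP2…P5` (here), `rowP6 := world_rowP6 χ hL` (Kit), `rowS5 := ⟨world_rowS5_additive χ hne hL, world_rowS5_theta χ,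
  world_psi_nonneg_mono hL⟩` (Kit, Kit, Psi); probe `example : MenuConsistentPrimes := menuConsistentPrimes_holds`.
  SCOPE NOTE (ls-barrier-plan 21:40:19Z (b)): the prime menu is the rows rendered in `DHChainBarrierPrimes` (P7: BMOR18 L6.12,
  TZ-MathZ Thm 1 / Cor 5 both cases, Xylouris Thm 2.1; S5); the outside-M item «Kadiri `∃R₀`» is implied by row08 via p467190;
  Brun–Titchmarsh, `wright2023`, the Linnik-box `∃q₀` rows, TZ Thm 7 (`∃C`), `ψ − θ` bookkeeping and the UniformABC row stay
  OUTSIDE by id (any further row re-opens the certificate).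

[cite: ThornerZaman2024PNTAP, Theorem 1, Corollary 5; BennettMartinOBryantRechnitzer2018, Lemma 6.12; Xylouris2011Thesis, Theorem 2.1;
Zhang2022LandauSiegel, §2 Assumption (A)]
-/

noncomputable section

open scoped Classical

namespace Literature.NumberTheory.LFunctions.Zhang2022.DH

open ThornerZaman2024PNTAP

/-! ### §0. Numerics of `β₁ = betaExc D` -/

section Beta

variable {D : ℕ} (hL : (43250 : ℝ) ≤ Real.log D)
include hL

/-- `β₁ > 0`. [cite: Zhang2022LandauSiegel, §2 Assumption (A)] -/
theorem betaExc_pos : 0 < betaExc D := lt_trans (by norm_num) (half_lt_betaExc hL)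

/-- `β₁ > 0.99` (indeed `β₁ > 1 − 1/432 500`). [cite: Zhang2022LandauSiegel, §2 Assumption (A)] -/
theorem betaExc_gt_099 : 0.99 < betaExc D := by
  have h := (betaExc_window hL).1
  have : 1 / (10 * Real.log D) ≤ 1 / (10 * 43250) :=
    div_le_div_of_nonneg_left (by norm_num) (by norm_num) (by linarith)
  linarith

/-- `1/β₁ ≤ 1.02`. [cite: Zhang2022LandauSiegel, §2 Assumption (A)] -/
theorem inv_betaExc_le : 1 / betaExc D ≤ 1.02 := by
  rw [div_le_iff₀ (betaExc_pos hL)]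
  linarith [betaExc_gt_099 hL]

/-- `−1 < β₁ − 1 < 0`: the exponent of the Siegel term is integrable at `0` and negative.
[cite: ThornerZaman2024PNTAP, Theorem 1 (1.4) p.3] -/
theorem betaExc_sub_one_bounds : -1 < betaExc D - 1 ∧ betaExc D - 1 < 0 := by
  constructor <;> linarith [betaExc_pos hL, (betaExc_window hL).2]

end Beta

/-! ### §1. The integrand `1 − s t^{β₁−1}` on ARBITRARY intervals, and the sign datum on induced moduli -/

section Integrand

variable {D : ℕ}

/-- For `|s| ≤ 1` and `t ≥ 0`: `|1 − s t^{β₁−1}| ≤ 1 + t^{β₁−1}`. [cite: ThornerZaman2024PNTAP, Theorem 1 (1.4) p.3] -/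
theorem abs_integrand_le {s : ℝ} (hs : |s| ≤ 1) {t : ℝ} (ht : 0 ≤ t) :
    |1 - s * t ^ (betaExc D - 1)| ≤ 1 + t ^ (betaExc D - 1) := by
  have h3 : 0 ≤ t ^ (betaExc D - 1) := Real.rpow_nonneg ht _
  calc |1 - s * t ^ (betaExc D - 1)| ≤ |(1 : ℝ)| + |s * t ^ (betaExc D - 1)| := abs_sub _ _
    _ = 1 + |s| * t ^ (betaExc D - 1) := by rw [abs_one, abs_mul, abs_of_nonneg h3]
    _ ≤ 1 + 1 * t ^ (betaExc D - 1) := by gcongr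
    _ = 1 + t ^ (betaExc D - 1) := by ring

/-- The integrand is interval-integrable on every interval (`β₁ − 1 > −1`). [cite: ThornerZaman2024PNTAP, Theorem 1 (1.4) p.3] -/
theorem intervalIntegrable_integrand (hL : (43250 : ℝ) ≤ Real.log D) (s a b : ℝ) :
    IntervalIntegrable (fun t : ℝ => 1 - s * t ^ (betaExc D - 1)) MeasureTheory.volume a b :=
  intervalIntegrable_const.sub
    ((intervalIntegral.intervalIntegrable_rpow' (betaExc_sub_one_bounds hL).1).const_mul s)

/-- **Closed form**: `∫_a^b (1 − s t^{β₁−1}) dt = (b − a) − s (b^{β₁} − a^{β₁})/β₁`.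
[cite: ThornerZaman2024PNTAP, Theorem 1 (1.4) p.3] -/
theorem integral_integrand (hL : (43250 : ℝ) ≤ Real.log D) (s a b : ℝ) :
    ∫ t in a..b, (1 - s * t ^ (betaExc D - 1)) = (b - a) - s * ((b ^ betaExc D - a ^ betaExc D) / betaExc D) := by
  have hr : -1 < betaExc D - 1 := (betaExc_sub_one_bounds hL).1
  rw [intervalIntegral.integral_sub intervalIntegrable_const
      ((intervalIntegral.intervalIntegrable_rpow' hr).const_mul s),
    intervalIntegral.integral_const, intervalIntegral.integral_const_mul, integral_rpow (Or.inl hr)]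
  simp only [sub_add_cancel, smul_eq_mul, mul_one]

/-- `∫_a^b (1 + t^{β₁−1}) dt = (b − a) + (b^{β₁} − a^{β₁})/β₁`. [cite: ThornerZaman2024PNTAP, Theorem 1 (1.4) p.3] -/
theorem integral_one_add_rpow (hL : (43250 : ℝ) ≤ Real.log D) (a b : ℝ) :
    ∫ t in a..b, (1 + t ^ (betaExc D - 1)) = (b - a) + (b ^ betaExc D - a ^ betaExc D) / betaExc D := by
  have hr : -1 < betaExc D - 1 := (betaExc_sub_one_bounds hL).1
  rw [intervalIntegral.integral_add intervalIntegrable_const (intervalIntegral.intervalIntegrable_rpow' hr),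
    intervalIntegral.integral_const, integral_rpow (Or.inl hr)]
  simp only [sub_add_cancel, smul_eq_mul, mul_one]

variable (χ : DirichletCharacter ℂ D)

/-- On an induced modulus the sign datum is the real part of the induced character. [cite: ThornerZaman2024PNTAP, Theorem 1 p.3] -/
theorem siegelSign_of_dvd {q : ℕ} (hd : D ∣ q) (a : ZMod q) :
    siegelSign D χ q a = ((DirichletCharacter.changeLevel hd χ) a).re := by
  unfold siegelSign
  rw [dif_pos hd]

end Integrand

/-! ### §2. The exceptional pair over `W`, the error denominators, and the decay bookkeeping -/

section Pair

variable {D : ℕ} {χ : DirichletCharacter ℂ D} (hL : (43250 : ℝ) ≤ Real.log D)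

/-- `log q ≥ log 2 > 0.69` for `q ≥ 2`. [cite: ThornerZaman2024PNTAP, §1 p.3] -/
theorem log_two_le_log {q : ℕ} (hq : 2 ≤ q) : 0.6931471803 < Real.log q := by
  have hq2 : (2 : ℝ) ≤ q := by exact_mod_cast hq
  exact lt_of_lt_of_le Real.log_two_gt_d9 (Real.log_le_log (by norm_num) hq2)

/-- Thorner–Zaman's window `β ≥ 1 − 1/(50 log q)` lies above `½` (`q ≥ 2`). [cite: ThornerZaman2024PNTAP, §1 p.3] -/
theorem half_lt_of_fifty_window {q : ℕ} (hq : 2 ≤ q) {β : ℝ} (h : 1 - 1 / (50 * Real.log q) ≤ β) : 1 / 2 < β := by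
  have hl := log_two_le_log hq
  have h1 : 1 / (50 * Real.log q) ≤ 1 / (50 * 0.6931471803) :=
    div_le_div_of_nonneg_left (by norm_num) (by norm_num) (by linarith)
  have h2 : (1 : ℝ) / (50 * 0.6931471803) < 1 / 2 := by norm_num
  linarith

include hL in
/-- **An exceptional pair over `W(D, χ)` at level `q ≥ 2` IS the induced slot with the zero `β₁(D)`.**
[cite: ThornerZaman2024PNTAP, §1 p.3] -/
theorem exceptionalPair_world {q : ℕ} (hq : 2 ≤ q) {χ₁ : DirichletCharacter ℂ q} {β : ℝ}
    (h : (world D χ).exceptionalPair χ₁ β) : IsExcSlot D χ q χ₁ ∧ β = betaExc D := by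
  obtain ⟨-, -, hwin, -, hz⟩ := h
  exact real_zero_gt_half hL hz (half_lt_of_fifty_window hq hwin)

/-- The induced character of a quadratic character is quadratic. [cite: MontgomeryVaughan2007, §9.1] -/
theorem isQuadratic_changeLevel (hquad : χ.IsQuadratic) {q : ℕ} (hd : D ∣ q) :
    (DirichletCharacter.changeLevel hd χ).IsQuadratic := by
  intro a
  by_cases ha : IsUnit a
  · obtain ⟨u, rfl⟩ := ha
    rw [DirichletCharacter.changeLevel_eq_cast_of_dvd χ hd u]
    exact hquad _
  · exact Or.inl (MulChar.map_nonunit _ ha)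

include hL in
/-- **«No exceptional pair at `q`» on an induced modulus `D ∣ q` forces `β₁(D) < 1 − 1/(50 log q)`** — the induced character
is nontrivial, quadratic, and has the zero `β₁(D) < 1`, so only the window can fail (`χ` quadratic, `χ ≠ χ₀`).
[cite: ThornerZaman2024PNTAP, §1 p.3] -/
theorem betaExc_lt_of_no_exceptionalPair (hquad : χ.IsQuadratic) (hne : χ ≠ 1) {q : ℕ} [NeZero q] (hd : D ∣ q)
    (hno : ∀ (χ₁ : DirichletCharacter ℂ q) (β₁ : ℝ), ¬ (world D χ).exceptionalPair χ₁ β₁) :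
    betaExc D < 1 - 1 / (50 * Real.log q) := by
  by_contra hge
  push Not at hge
  refine hno (DirichletCharacter.changeLevel hd χ) (betaExc D) ⟨?_, isQuadratic_changeLevel hquad hd, hge,
    (betaExc_window hL).2, (isZero_betaExc_of_exc χ ⟨hd, rfl⟩).1⟩
  exact fun h1 => hne ((DirichletCharacter.changeLevel_eq_one_iff hd).1 h1)

/-- **`errDenom q x h ≥ log q`** for `4 ≤ h ≤ x`: the other two summands are products of real powers of non-negative reals
(`log(x/h) ≥ 0`, `log log x ≥ 0` as `x ≥ 4 > e`). [cite: ThornerZaman2024PNTAP, Theorem 1 p.3] -/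
theorem log_le_errDenom {q : ℕ} {x h : ℝ} (h4 : 4 ≤ h) (hhx : h ≤ x) : Real.log q ≤ errDenom q x h := by
  unfold errDenom
  have hh0 : 0 < h := by linarith
  have hx1 : 1 ≤ x / h := by rw [le_div_iff₀ hh0]; linarith
  have hlogxh : 0 ≤ Real.log (x / h) := Real.log_nonneg hx1
  have hlogx : 1 ≤ Real.log x := by
    rw [Real.le_log_iff_exp_le (by linarith)]
    linarith [Real.exp_one_lt_d9]
  have hloglog : 0 ≤ Real.log (Real.log x) := Real.log_nonneg hlogx
  have t1 : 0 ≤ Real.log (x / h) ^ ((2 : ℝ) / 3) * (max 0 (Real.log (Real.log (x / h)))) ^ ((1 : ℝ) / 3) :=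
    mul_nonneg (Real.rpow_nonneg hlogxh _) (Real.rpow_nonneg (le_max_left _ _) _)
  have t2 : 0 ≤ Real.log x ^ ((2 : ℝ) / 5) * Real.log (Real.log x) ^ ((1 : ℝ) / 5) :=
    mul_nonneg (Real.rpow_nonneg (by linarith) _) (Real.rpow_nonneg hloglog _)
  linarith

/-- The decay factor with `errDenom` dominates the one with `log q` (`c = 1/50`, `q ≥ 2`, `4 ≤ h ≤ x`).
[cite: ThornerZaman2024PNTAP, Theorem 1 p.3] -/
theorem exp_logq_le_exp_errDenom {q : ℕ} (hq : 2 ≤ q) {x h : ℝ} (h4 : 4 ≤ h) (hhx : h ≤ x) :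
    Real.exp (-(1 / 50) * Real.log x / Real.log q) ≤ Real.exp (-(1 / 50) * Real.log x / errDenom q x h) := by
  have hlogq : 0 < Real.log q := by linarith [log_two_le_log hq]
  have hE := log_le_errDenom (q := q) h4 hhx
  have hlogx : 0 ≤ Real.log x := Real.log_nonneg (by linarith)
  rw [Real.exp_le_exp, neg_mul, neg_div, neg_div, neg_le_neg_iff]
  exact div_le_div_of_nonneg_left (by positivity) hlogq hE

/-- **`x^{β−1} ≤ e^{−(1/50) log x/log q}`** once `β ≤ 1 − 1/(50 log q)` (`x ≥ 1`, `log q > 0`).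
[cite: ThornerZaman2024PNTAP, Theorem 1 p.3] -/
theorem rpow_le_decay {q : ℕ} (hq : 2 ≤ q) {β x : ℝ} (hβ : β ≤ 1 - 1 / (50 * Real.log q)) (hx : 1 ≤ x) :
    x ^ (β - 1) ≤ Real.exp (-(1 / 50) * Real.log x / Real.log q) := by
  have hlogq : 0 < Real.log q := by linarith [log_two_le_log hq]
  have hlogx : 0 ≤ Real.log x := Real.log_nonneg hx
  rw [Real.rpow_def_of_pos (by linarith), Real.exp_le_exp]
  have h1 : β - 1 ≤ -(1 / (50 * Real.log q)) := by linarith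
  calc Real.log x * (β - 1) ≤ Real.log x * (-(1 / (50 * Real.log q))) := mul_le_mul_of_nonneg_left h1 hlogx
    _ = -(1 / 50) * Real.log x / Real.log q := by field_simp

/-- **`1 ≤ y · e^{−(1/50) log x/log q}`** once `y ≥ x^p` with `p ≥ 1/25` (`x ≥ 1`, `q ≥ 2`: `1/(50 log q) ≤ 1/(50 log 2) < 1/25`).
[cite: ThornerZaman2024PNTAP, Theorem 1 p.3] -/
theorem one_le_mul_decay {q : ℕ} (hq : 2 ≤ q) {x y p : ℝ} (hx : 1 ≤ x) (hp : 1 / 25 ≤ p) (hy : x ^ p ≤ y) :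
    1 ≤ y * Real.exp (-(1 / 50) * Real.log x / Real.log q) := by
  have hl := log_two_le_log hq
  have hlogq : 0 < Real.log q := by linarith
  have hlogx : 0 ≤ Real.log x := Real.log_nonneg hx
  have hx0 : 0 < x := by linarith
  have hE0 : 0 < Real.exp (-(1 / 50) * Real.log x / Real.log q) := Real.exp_pos _
  have hc : 1 / (50 * Real.log q) ≤ 1 / 25 := by
    rw [div_le_div_iff₀ (by positivity) (by norm_num)]
    linarith
  have hxp : 0 < x ^ p := Real.rpow_pos_of_pos hx0 _
  calc (1 : ℝ) = Real.exp 0 := (Real.exp_zero).symm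
    _ ≤ Real.exp (Real.log x * p + -(1 / 50) * Real.log x / Real.log q) := by
        rw [Real.exp_le_exp]
        have : Real.log x * p + -(1 / 50) * Real.log x / Real.log q = Real.log x * (p - 1 / (50 * Real.log q)) := by
          field_simp
          ring
        rw [this]
        exact mul_nonneg hlogx (by linarith)
    _ = x ^ p * Real.exp (-(1 / 50) * Real.log x / Real.log q) := by
        rw [Real.exp_add, Real.rpow_def_of_pos hx0]
    _ ≤ y * Real.exp (-(1 / 50) * Real.log x / Real.log q) := by gcongr

/-- **The one estimate with content: `x^β − m^β ≤ 4 h x^{β−1}` for `1 ≤ m ≤ x`, `x − m ≤ h`, `0 < β ≤ 1`.** If `x ≤ 2m`,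
Bernoulli's inequality `(x/m)^β ≤ 1 + β(x/m − 1)` gives `x^β − m^β ≤ β m^{β−1}(x − m) ≤ (x/2)^{β−1} h ≤ 2 x^{β−1} h`; if
`x > 2m` then `h ≥ x − m > x/2` and `x^β − m^β ≤ x^β = x·x^{β−1} < 2h x^{β−1}`. [cite: ThornerZaman2024PNTAP, Theorem 1 (1.4) p.3] -/
theorem rpow_sub_rpow_le_four_mul {β : ℝ} (hβ0 : 0 < β) (hβ1 : β ≤ 1) {m x h : ℝ} (hm1 : 1 ≤ m) (hmx : m ≤ x)
    (hxmh : x - m ≤ h) : x ^ β - m ^ β ≤ 4 * h * x ^ (β - 1) := by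
  have hm0 : 0 < m := by linarith
  have hx0 : 0 < x := by linarith
  have hh0 : 0 ≤ h := by linarith
  have hxr : 0 < x ^ (β - 1) := Real.rpow_pos_of_pos hx0 _
  by_cases hcase : x ≤ 2 * m
  · -- Bernoulli at base `m`
    have hs : -1 ≤ x / m - 1 := by
      have : 0 ≤ x / m := by positivity
      linarith
    have hB := rpow_one_add_le_one_add_mul_self hs hβ0.le hβ1
    have e1 : 1 + (x / m - 1) = x / m := by ring
    rw [e1, Real.div_rpow hx0.le hm0.le] at hB
    have hmβ : 0 < m ^ β := Real.rpow_pos_of_pos hm0 _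
    have hmβ1 : m ^ (β - 1) = m ^ β / m := Real.rpow_sub_one hm0.ne' β
    -- `x^β ≤ m^β + β m^{β−1} (x − m)`
    have h1 : x ^ β ≤ m ^ β + β * m ^ (β - 1) * (x - m) := by
      have h := (div_le_iff₀ hmβ).1 hB
      have e2 : (1 + β * (x / m - 1)) * m ^ β = m ^ β + β * (m ^ β / m) * (x - m) := by
        field_simp
      rw [hmβ1]
      linarith [e2]
    -- `m^{β−1} ≤ (x/2)^{β−1} ≤ 2 x^{β−1}`
    have h2 : m ^ (β - 1) ≤ 2 * x ^ (β - 1) := by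
      have hx2m : x / 2 ≤ m := by linarith
      have h2r : (1 : ℝ) / 2 ≤ (2 : ℝ) ^ (β - 1) := by
        have := Real.rpow_le_rpow_of_exponent_le (show (1 : ℝ) ≤ 2 by norm_num) (show (-1 : ℝ) ≤ β - 1 by linarith)
        rwa [Real.rpow_neg_one, ← one_div] at this
      have h2pos : (0 : ℝ) < 2 ^ (β - 1) := Real.rpow_pos_of_pos two_pos _
      have hinv : ((2 : ℝ) ^ (β - 1))⁻¹ ≤ 2 := by
        rw [inv_le_comm₀ h2pos two_pos, ← one_div]
        exact h2r
      calc m ^ (β - 1) ≤ (x / 2) ^ (β - 1) := Real.rpow_le_rpow_of_nonpos (by positivity) hx2m (by linarith)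
        _ = x ^ (β - 1) * ((2 : ℝ) ^ (β - 1))⁻¹ := by
            rw [div_eq_mul_inv, Real.mul_rpow hx0.le (by norm_num), Real.inv_rpow zero_le_two]
        _ ≤ x ^ (β - 1) * 2 := by gcongr
        _ = 2 * x ^ (β - 1) := by ring
    have hm_r : 0 ≤ m ^ (β - 1) := Real.rpow_nonneg hm0.le _
    have hxm0 : 0 ≤ x - m := by linarith
    calc x ^ β - m ^ β ≤ β * m ^ (β - 1) * (x - m) := by linarith
      _ ≤ 1 * (2 * x ^ (β - 1)) * h := by gcongr
      _ ≤ 4 * h * x ^ (β - 1) := by nlinarith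
  · -- `x > 2m`: `h > x/2`
    push Not at hcase
    have hmβ : 0 ≤ m ^ β := Real.rpow_nonneg hm0.le _
    have e : x ^ β = x * x ^ (β - 1) := by
      rw [Real.rpow_sub_one hx0.ne']
      field_simp
    calc x ^ β - m ^ β ≤ x ^ β := by linarith
      _ = x * x ^ (β - 1) := e
      _ ≤ (2 * h) * x ^ (β - 1) := by gcongr; linarith
      _ ≤ 4 * h * x ^ (β - 1) := by nlinarith

end Pair

/-! ### §3. The prime rows P2–P5 on `(world D χ, primeWorld D χ)`, each with the field's statement verbatim -/

section Rows

variable {D : ℕ} {χ : DirichletCharacter ℂ D} (hL : (43250 : ℝ) ≤ Real.log D)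

/-- `φ(q) ≥ 1` as a real number (`q ≥ 1`). [folklore] -/
private theorem one_le_totient {q : ℕ} [NeZero q] : (1 : ℝ) ≤ (Nat.totient q : ℝ) := by
  exact_mod_cast Nat.totient_pos.2 (NeZero.pos q)

/-- `|x − max(x−h,1) − h| ≤ 1` for `0 ≤ h ≤ x` (the cut-off at `t = 1` costs at most `1`). [folklore] -/
private theorem abs_cutoff_le {x h : ℝ} (hhx : h ≤ x) : |x - max (x - h) 1 - h| ≤ 1 := by
  rw [abs_le]
  constructor
  · have : max (x - h) 1 ≤ x - h + 1 := max_le (by linarith) (by linarith)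
    linarith
  · have := le_max_left (x - h) 1
    linarith

include hL

/-- **Row P7/TZ1 (Thorner–Zaman Theorem 1, regular case) on the world**, witnesses `c = 1/50`, `K = 6`: for a unit `a`,
`4 ≤ h ≤ x`, `h ≥ φ(q)x^{7/12+ε}` and «no exceptional pair at `q`», `|θ_W − h/φ| ≤ 6 (h/φ) e^{−(1/50) log x/errDenom}` —
on `D ∤ q` the error is the cut-off `≤ 1/φ`; on `D ∣ q` it is `≤ (1 + 4·1.02·h·x^{−δ})/φ` (`rpow_sub_rpow_le_four_mul`) with
`δ > 1/(50 log q)` forced by the hypothesis (`betaExc_lt_of_no_exceptionalPair`). [cite: ThornerZaman2024PNTAP, Theorem 1 p.3] -/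
theorem world_rowP2 (hquad : χ.IsQuadratic) (hne : χ ≠ 1) :
    ∀ ε : ℝ, 0 < ε → ε < 1 - 7 / 12 → ∃ c : ℝ, 0 < c ∧ ∃ K : ℝ, 0 ≤ K ∧
      ∀ (q : ℕ) [NeZero q], 2 ≤ q →
        (∀ (χ₁ : DirichletCharacter ℂ q) (β₁ : ℝ), ¬ (world D χ).exceptionalPair χ₁ β₁) →
        ∀ (a : ZMod q), IsUnit a → ∀ (x h : ℝ), 4 ≤ h → h ≤ x → x ^ (7 / 12 + ε) ≤ h / Nat.totient q →
          |(primeWorld D χ).theta q a x h - h / Nat.totient q| ≤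
            K * (h / Nat.totient q) * Real.exp (-c * Real.log x / errDenom q x h) := by
  intro ε hε _
  refine ⟨1 / 50, by norm_num, 6, by norm_num, ?_⟩
  intro q _ hq hno a ha x h h4 hhx hxh
  have hφ : (1 : ℝ) ≤ (Nat.totient q : ℝ) := one_le_totient
  have hφ0 : (0 : ℝ) < Nat.totient q := by linarith
  have hx1 : 1 ≤ x := by linarith
  have hh0 : 0 ≤ h := by linarith
  have hM : max x 1 = x := max_eq_left hx1
  set m : ℝ := max (x - h) 1 with hm
  have hm1 : 1 ≤ m := le_max_right _ _
  have hmx : m ≤ x := max_le (by linarith) hx1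
  have hxmh : x - m ≤ h := by
    have := le_max_left (x - h) 1
    linarith
  set s : ℝ := siegelSign D χ q a with hs
  have hs1 : |s| ≤ 1 := abs_siegelSign_le D χ q a
  set β : ℝ := betaExc D with hβ
  have hβ0 : 0 < β := betaExc_pos hL
  have hβ1 : β < 1 := (betaExc_window hL).2
  have hβinv : 1 / β ≤ 1.02 := inv_betaExc_le hL
  -- the two decay factors
  set E : ℝ := Real.exp (-(1 / 50) * Real.log x / Real.log q) with hE
  have hEE' : E ≤ Real.exp (-(1 / 50) * Real.log x / errDenom q x h) := exp_logq_le_exp_errDenom hq h4 hhx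
  have hE0 : 0 < E := Real.exp_pos _
  have hxh' : x ^ (7 / 12 + ε) ≤ h := hxh.trans (div_le_self hh0 hφ)
  have hhE : 1 ≤ h * E := one_le_mul_decay hq hx1 (by linarith) hxh'
  -- the numerator
  have hnum : |(x - m - h) - s * ((x ^ β - m ^ β) / β)| ≤ 6 * h * E := by
    by_cases hd : D ∣ q
    · have hδ : β < 1 - 1 / (50 * Real.log q) := betaExc_lt_of_no_exceptionalPair hL hquad hne hd hno
      have hxE : x ^ (β - 1) ≤ E := rpow_le_decay hq hδ.le hx1
      have hkey : x ^ β - m ^ β ≤ 4 * h * x ^ (β - 1) := rpow_sub_rpow_le_four_mul hβ0 hβ1.le hm1 hmx hxmh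
      have hP0 : 0 ≤ x ^ β - m ^ β := sub_nonneg.2 (Real.rpow_le_rpow (by linarith) hmx hβ0.le)
      have hP0' : 0 ≤ (x ^ β - m ^ β) / β := div_nonneg hP0 hβ0.le
      calc |(x - m - h) - s * ((x ^ β - m ^ β) / β)| ≤ |x - m - h| + |s * ((x ^ β - m ^ β) / β)| := abs_sub _ _
        _ ≤ 1 + 1 * ((x ^ β - m ^ β) / β) := by
            gcongr
            · exact abs_cutoff_le hhx
            · rw [abs_mul, abs_of_nonneg hP0']
              exact mul_le_mul_of_nonneg_right hs1 hP0'
        _ = 1 + (1 / β) * (x ^ β - m ^ β) := by ring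
        _ ≤ 1 + (1 / β) * (4 * h * x ^ (β - 1)) := by gcongr
        _ ≤ h * E + 1.02 * (4 * h * E) := by gcongr
        _ ≤ 6 * h * E := by nlinarith
    · have hs0 : s = 0 := siegelSign_of_not_dvd χ hd a
      rw [hs0, zero_mul, sub_zero]
      calc |x - m - h| ≤ 1 := abs_cutoff_le hhx
        _ ≤ h * E := hhE
        _ ≤ 6 * h * E := by nlinarith
  -- assemble
  rw [primeWorld_theta_closed χ hL ha, hM, ← sub_div, abs_div, abs_of_pos hφ0, div_le_iff₀ hφ0]
  calc |x - m - s * ((x ^ β - m ^ β) / β) - h| = |(x - m - h) - s * ((x ^ β - m ^ β) / β)| := by ring_nf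
    _ ≤ 6 * h * E := hnum
    _ ≤ 6 * h * Real.exp (-(1 / 50) * Real.log x / errDenom q x h) := by gcongr
    _ = 6 * (h / Nat.totient q) * Real.exp (-(1 / 50) * Real.log x / errDenom q x h) * Nat.totient q := by
        field_simp

/-- **Row P7/TZ1′ (Thorner–Zaman Theorem 1, exceptional case) on the world**, witnesses `c = 1/50`, `K = 3`: the exceptional
pair is `(changeLevel χ, β₁(D))` (`exceptionalPair_world`), so `s = Re χ₁(a)` and `θ_W` is the printed main term
`λ(x,q,a,h)·h/φ(q)` EXACTLY when `x − h ≥ 1`; otherwise they differ by `|∫_{x−h}^{1}(1 − s t^{β₁−1})dt|/φ ≤ 1 + 1/β₁ ≤ 2.02`,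
while `K·(λh/φ)·e^{−c log x/errDenom} ≥ 3` because `λh/φ ≥ x^{71/75+ε}`. [cite: ThornerZaman2024PNTAP, Theorem 1 p.3] -/
theorem world_rowP3 :
    ∀ ε : ℝ, 0 < ε → ε < 1 - 71 / 75 → ∃ c : ℝ, 0 < c ∧ ∃ K : ℝ, 0 ≤ K ∧
      ∀ (q : ℕ) [NeZero q], 2 ≤ q → ∀ (χ₁ : DirichletCharacter ℂ q) (β₁ : ℝ), (world D χ).exceptionalPair χ₁ β₁ →
        ∀ (a : ZMod q), IsUnit a → ∀ (x h : ℝ), 4 ≤ h → h ≤ x →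
          x ^ (71 / 75 + ε) ≤ lambdaExc χ₁ β₁ a x h * h / Nat.totient q →
            |(primeWorld D χ).theta q a x h - lambdaExc χ₁ β₁ a x h * h / Nat.totient q| ≤
              K * (lambdaExc χ₁ β₁ a x h * h / Nat.totient q) * Real.exp (-c * Real.log x / errDenom q x h) := by
  intro ε hε _
  refine ⟨1 / 50, by norm_num, 3, by norm_num, ?_⟩
  intro q _ hq χ₁ β₁ hpair a ha x h h4 hhx hmain
  obtain ⟨hslot, rfl⟩ := exceptionalPair_world hL hq hpair
  obtain ⟨hd, rfl⟩ := hslot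
  have hφ : (1 : ℝ) ≤ (Nat.totient q : ℝ) := one_le_totient
  have hφ0 : (0 : ℝ) < Nat.totient q := by linarith
  have hx1 : 1 ≤ x := by linarith
  have hh0 : 0 < h := by linarith
  have hM : max x 1 = x := max_eq_left hx1
  have hs : siegelSign D χ q a = ((DirichletCharacter.changeLevel hd χ) a).re := siegelSign_of_dvd χ hd a
  set s : ℝ := ((DirichletCharacter.changeLevel hd χ) a).re with hsdef
  have hs1 : |s| ≤ 1 := by rw [← hs]; exact abs_siegelSign_le D χ q a
  set g : ℝ → ℝ := fun t => 1 - s * t ^ (betaExc D - 1) with hg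
  -- the main term is `(∫_{x−h}^x g)/φ`
  set main : ℝ := lambdaExc (DirichletCharacter.changeLevel hd χ) (betaExc D) a x h * h / Nat.totient q
    with hmaindef
  have hmain_eq : main = (∫ t in (x - h)..x, g t) / Nat.totient q := by
    rw [hmaindef, lambdaExc]
    field_simp
    rfl
  -- the decay: `1 ≤ main · E ≤ main · E'`
  set E : ℝ := Real.exp (-(1 / 50) * Real.log x / Real.log q) with hE
  have hEE' : E ≤ Real.exp (-(1 / 50) * Real.log x / errDenom q x h) := exp_logq_le_exp_errDenom hq h4 hhx
  have hmain0 : 0 ≤ main := le_trans (Real.rpow_nonneg (by linarith) _) hmain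
  have hmE : 1 ≤ main * E := one_le_mul_decay hq hx1 (by linarith) hmain
  have hallow : 3 ≤ 3 * main * Real.exp (-(1 / 50) * Real.log x / errDenom q x h) := by
    have : main * E ≤ main * Real.exp (-(1 / 50) * Real.log x / errDenom q x h) :=
      mul_le_mul_of_nonneg_left hEE' hmain0
    nlinarith
  -- `θ_W = (∫_m^x g)/φ`, and the difference is `(∫_{x−h}^m g)/φ`
  have hθ : (primeWorld D χ).theta q a x h = (∫ t in max (x - h) 1..x, g t) / Nat.totient q := by
    rw [primeWorld_theta_of_isUnit χ ha, hM, hs]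
  have hint : IntervalIntegrable g MeasureTheory.volume (x - h) (max (x - h) 1) ∧
      IntervalIntegrable g MeasureTheory.volume (max (x - h) 1) x :=
    ⟨intervalIntegrable_integrand hL _ _ _, intervalIntegrable_integrand hL _ _ _⟩
  have hsplit : (∫ t in (x - h)..x, g t) =
      (∫ t in (x - h)..max (x - h) 1, g t) + ∫ t in max (x - h) 1..x, g t :=
    (intervalIntegral.integral_add_adjacent_intervals hint.1 hint.2).symm
  have hdiff : (primeWorld D χ).theta q a x h - main = -(∫ t in (x - h)..max (x - h) 1, g t) / Nat.totient q := by
    rw [hθ, hmain_eq, hsplit]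
    ring
  -- the cut-off integral is at most `1 + 1/β₁ ≤ 2.02`
  have hcut : |∫ t in (x - h)..max (x - h) 1, g t| ≤ 2.02 := by
    by_cases h1 : 1 ≤ x - h
    · rw [max_eq_left h1, intervalIntegral.integral_same, abs_zero]
      norm_num
    · push Not at h1
      rw [max_eq_right h1.le]
      have hxh0 : 0 ≤ x - h := by linarith
      have hβ0 : 0 < betaExc D := betaExc_pos hL
      have hle : x - h ≤ 1 := h1.le
      calc |∫ t in (x - h)..1, g t| ≤ ∫ t in (x - h)..1, |g t| :=
            intervalIntegral.abs_integral_le_integral_abs hle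
        _ ≤ ∫ t in (x - h)..1, (1 + t ^ (betaExc D - 1)) := by
            refine intervalIntegral.integral_mono_on hle (intervalIntegrable_integrand hL _ _ _).abs
              (intervalIntegrable_const.add
                (intervalIntegral.intervalIntegrable_rpow' (betaExc_sub_one_bounds hL).1)) fun t ht => ?_
            exact abs_integrand_le hs1 (hxh0.trans ht.1)
        _ = (1 - (x - h)) + (1 ^ betaExc D - (x - h) ^ betaExc D) / betaExc D := integral_one_add_rpow hL _ _
        _ ≤ 1 + 1 / betaExc D := by
            rw [Real.one_rpow]
            have h0 : 0 ≤ (x - h) ^ betaExc D := Real.rpow_nonneg hxh0 _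
            have hA : 1 - (x - h) ≤ 1 := by linarith
            have hB : (1 - (x - h) ^ betaExc D) / betaExc D ≤ 1 / betaExc D :=
              div_le_div_of_nonneg_right (by linarith) hβ0.le
            linarith
        _ ≤ 2.02 := by linarith [inv_betaExc_le hL]
  rw [hdiff, abs_div, abs_neg, abs_of_pos hφ0]
  calc |∫ t in (x - h)..max (x - h) 1, g t| / Nat.totient q ≤ 2.02 / 1 :=
        div_le_div₀ (by norm_num) hcut one_pos hφ
    _ ≤ 3 := by norm_num
    _ ≤ 3 * main * Real.exp (-(1 / 50) * Real.log x / errDenom q x h) := hallow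

/-- **Row P7/TZ5 (Thorner–Zaman Corollary 5, regular case, `h = x`) on the world**, witnesses `c = 1/50`, `K = 3`:
`θ_W(x;q,a,x) = ((x − 1) − s(x^{β₁} − 1)/β₁)/φ`, so `|θ_W − x/φ| ≤ (1 + [D ∣ q]·x^{β₁}/β₁)/φ ≤ 3 (x/φ) e^{−(1/50) log x/log q}`
(«no exceptional pair» ⇒ `x^{−δ} ≤ e^{−(1/50)log x/log q}` on `D ∣ q`; `1 ≤ x·e^{−(1/50)log x/log q}`). [cite: ThornerZaman2024PNTAP, Corollary 5 p.4] -/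
theorem world_rowP4 (hquad : χ.IsQuadratic) (hne : χ ≠ 1) : ∃ c : ℝ, 0 < c ∧ ∃ K : ℝ, 0 ≤ K ∧
    ∀ (q : ℕ) [NeZero q], 2 ≤ q →
      (∀ (χ₁ : DirichletCharacter ℂ q) (β₁ : ℝ), ¬ (world D χ).exceptionalPair χ₁ β₁) →
      ∀ (a : ZMod q), IsUnit a → ∀ x : ℝ, 3 ≤ x → x ^ ((18 : ℝ) / 19) ≤ x / Nat.totient q →
        |(primeWorld D χ).theta q a x x - x / Nat.totient q| ≤
          K * (x / Nat.totient q) *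
            (Real.exp (-c * Real.log x / Real.log q) +
              Real.exp (-c * Real.log x ^ ((3 : ℝ) / 5) / Real.log (Real.log x) ^ ((1 : ℝ) / 5))) := by
  refine ⟨1 / 50, by norm_num, 3, by norm_num, ?_⟩
  intro q _ hq hno a ha x hx3 hxφ
  have hφ : (1 : ℝ) ≤ (Nat.totient q : ℝ) := one_le_totient
  have hφ0 : (0 : ℝ) < Nat.totient q := by linarith
  have hx1 : 1 ≤ x := by linarith
  have hx0 : 0 < x := by linarith
  have hM : max x 1 = x := max_eq_left hx1
  have hm : max (x - x) 1 = 1 := by simp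
  set s : ℝ := siegelSign D χ q a with hs
  have hs1 : |s| ≤ 1 := abs_siegelSign_le D χ q a
  set β : ℝ := betaExc D with hβ
  have hβ0 : 0 < β := betaExc_pos hL
  have hβ1 : β < 1 := (betaExc_window hL).2
  have hβinv : 1 / β ≤ 1.02 := inv_betaExc_le hL
  set E : ℝ := Real.exp (-(1 / 50) * Real.log x / Real.log q) with hE
  set E₂ : ℝ := Real.exp (-(1 / 50) * Real.log x ^ ((3 : ℝ) / 5) / Real.log (Real.log x) ^ ((1 : ℝ) / 5)) with hE₂
  have hE0 : 0 < E := Real.exp_pos _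
  have hE₂0 : 0 < E₂ := Real.exp_pos _
  have hxE : 1 ≤ x * E := one_le_mul_decay hq hx1 (by norm_num) (hxφ.trans (div_le_self hx0.le hφ))
  -- numerator: `(x − 1 − s (x^β − 1)/β) − x`
  have hnum : |(x - 1 - s * ((x ^ β - 1) / β)) - x| ≤ 3 * x * E := by
    have hxβ1 : 1 ≤ x ^ β := Real.one_le_rpow hx1 hβ0.le
    have hP0' : 0 ≤ (x ^ β - 1) / β := div_nonneg (by linarith) hβ0.le
    have h1 : |(x - 1 - s * ((x ^ β - 1) / β)) - x| ≤ 1 + |s| * ((x ^ β - 1) / β) := by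
      calc |(x - 1 - s * ((x ^ β - 1) / β)) - x| = |(-1) - s * ((x ^ β - 1) / β)| := by ring_nf
        _ ≤ |(-1 : ℝ)| + |s * ((x ^ β - 1) / β)| := abs_sub _ _
        _ = 1 + |s| * ((x ^ β - 1) / β) := by rw [abs_neg, abs_one, abs_mul, abs_of_nonneg hP0']
    by_cases hd : D ∣ q
    · have hδ : β < 1 - 1 / (50 * Real.log q) := betaExc_lt_of_no_exceptionalPair hL hquad hne hd hno
      have hxE' : x ^ (β - 1) ≤ E := rpow_le_decay hq hδ.le hx1
      have e : x ^ β = x * x ^ (β - 1) := by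
        rw [Real.rpow_sub_one hx0.ne']
        field_simp
      have hxβE : x ^ β ≤ x * E := by rw [e]; exact mul_le_mul_of_nonneg_left hxE' hx0.le
      calc |(x - 1 - s * ((x ^ β - 1) / β)) - x| ≤ 1 + |s| * ((x ^ β - 1) / β) := h1
        _ ≤ 1 + 1 * ((x ^ β - 1) / β) := by gcongr
        _ = 1 + (1 / β) * (x ^ β - 1) := by ring
        _ ≤ 1 + (1 / β) * (x * E) := by gcongr; linarith
        _ ≤ x * E + 1.02 * (x * E) := by gcongr
        _ ≤ 3 * x * E := by nlinarith
    · have hs0 : s = 0 := siegelSign_of_not_dvd χ hd a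
      calc |(x - 1 - s * ((x ^ β - 1) / β)) - x| ≤ 1 + |s| * ((x ^ β - 1) / β) := h1
        _ = 1 := by rw [hs0, abs_zero, zero_mul, add_zero]
        _ ≤ x * E := hxE
        _ ≤ 3 * x * E := by nlinarith
  rw [primeWorld_theta_closed χ hL ha, hM, hm, Real.one_rpow, ← sub_div, abs_div, abs_of_pos hφ0, div_le_iff₀ hφ0]
  calc |x - 1 - s * ((x ^ β - 1) / β) - x| ≤ 3 * x * E := hnum
    _ ≤ 3 * x * (E + E₂) := by nlinarith
    _ = 3 * (x / Nat.totient q) * (E + E₂) * Nat.totient q := by field_simp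

/-- **Row P7/TZ5′ (Thorner–Zaman Corollary 5, exceptional case) on the world**, witnesses `c = 1/50`, `K = 3`: with the
pair `(changeLevel χ, β₁(D))` and `s = Re χ₁(a)`, the printed main term is `(x − s x^{β₁}/β₁)/φ` and `θ_W(x;q,a,x) =
((x−1) − s(x^{β₁} − 1)/β₁)/φ`, so they differ by `|s/β₁ − 1|/φ ≤ 2.02`, while `K·main·(…) ≥ 3` as `main ≥ x^{18/19}`.
[cite: ThornerZaman2024PNTAP, Corollary 5 p.4] -/
theorem world_rowP5 : ∃ c : ℝ, 0 < c ∧ ∃ K : ℝ, 0 ≤ K ∧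
    ∀ (q : ℕ) [NeZero q], 2 ≤ q → ∀ (χ₁ : DirichletCharacter ℂ q) (β₁ : ℝ), (world D χ).exceptionalPair χ₁ β₁ →
      ∀ (a : ZMod q), IsUnit a → ∀ x : ℝ, 3 ≤ x →
        x ^ ((18 : ℝ) / 19) ≤ (1 - (χ₁ a).re * x ^ (β₁ - 1) / β₁) * x / Nat.totient q →
          |(primeWorld D χ).theta q a x x - (1 - (χ₁ a).re * x ^ (β₁ - 1) / β₁) * x / Nat.totient q| ≤
            K * ((1 - (χ₁ a).re * x ^ (β₁ - 1) / β₁) * x / Nat.totient q) *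
              (Real.exp (-c * Real.log x / Real.log q) +
                Real.exp (-c * Real.log x ^ ((3 : ℝ) / 5) / Real.log (Real.log x) ^ ((1 : ℝ) / 5))) := by
  refine ⟨1 / 50, by norm_num, 3, by norm_num, ?_⟩
  intro q _ hq χ₁ β₁ hpair a ha x hx3 hmain
  obtain ⟨hslot, rfl⟩ := exceptionalPair_world hL hq hpair
  obtain ⟨hd, rfl⟩ := hslot
  have hφ : (1 : ℝ) ≤ (Nat.totient q : ℝ) := one_le_totient
  have hφ0 : (0 : ℝ) < Nat.totient q := by linarith
  have hx1 : 1 ≤ x := by linarith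
  have hx0 : 0 < x := by linarith
  have hM : max x 1 = x := max_eq_left hx1
  have hm : max (x - x) 1 = 1 := by simp
  have hs : siegelSign D χ q a = ((DirichletCharacter.changeLevel hd χ) a).re := siegelSign_of_dvd χ hd a
  set s : ℝ := ((DirichletCharacter.changeLevel hd χ) a).re with hsdef
  have hs1 : |s| ≤ 1 := by rw [← hs]; exact abs_siegelSign_le D χ q a
  set β : ℝ := betaExc D with hβ
  have hβ0 : 0 < β := betaExc_pos hL
  have hβinv : 1 / β ≤ 1.02 := inv_betaExc_le hL
  set main : ℝ := (1 - s * x ^ (β - 1) / β) * x / Nat.totient q with hmaindef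
  set E : ℝ := Real.exp (-(1 / 50) * Real.log x / Real.log q) with hE
  set E₂ : ℝ := Real.exp (-(1 / 50) * Real.log x ^ ((3 : ℝ) / 5) / Real.log (Real.log x) ^ ((1 : ℝ) / 5)) with hE₂
  have hE₂0 : 0 < E₂ := Real.exp_pos _
  have hmain0 : 0 ≤ main := le_trans (Real.rpow_nonneg hx0.le _) hmain
  have hmE : 1 ≤ main * E := one_le_mul_decay hq hx1 (by norm_num) hmain
  have hallow : 3 ≤ 3 * main * (E + E₂) := by nlinarith
  -- the difference is `(s/β − 1)/φ`
  have e : x ^ (β - 1) = x ^ β / x := Real.rpow_sub_one hx0.ne' β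
  have hdiff : (primeWorld D χ).theta q a x x - main = (s / β - 1) / Nat.totient q := by
    rw [primeWorld_theta_closed χ hL ha, hM, hm, Real.one_rpow, hs, hmaindef, e, ← hβ]
    field_simp
    ring
  have hnum : |s / β - 1| ≤ 2.02 := by
    have h1 : |s / β| = |s| / β := by rw [abs_div, abs_of_pos hβ0]
    calc |s / β - 1| ≤ |s / β| + |(1 : ℝ)| := abs_sub _ _
      _ = |s| * (1 / β) + 1 := by rw [h1, abs_one]; ring
      _ ≤ 1 * 1.02 + 1 := by gcongr
      _ = 2.02 := by norm_num
  rw [hdiff, abs_div, abs_of_pos hφ0]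
  calc |s / β - 1| / Nat.totient q ≤ 2.02 / 1 := div_le_div₀ (by norm_num) hnum one_pos hφ
    _ ≤ 3 := by norm_num
    _ ≤ 3 * main * (E + E₂) := hallow

end Rows

/-! ### §4. The assembly: `MenuConsistentPrimes` -/

section Assembly

/-- **E-18b DECIDED: `MenuConsistentPrimes` holds** — for every modulus `D` with `log D ≥ 43 250` and every primitive quadratic
`χ ≠ χ₀` mod `D`, the (A)-world `world D χ` with the prime datum `primeWorld D χ` satisfies the whole rendered prime menu
`PrimeMenu (world D χ) (primeWorld D χ)`: `rowP1` = ls-Bdh-typer-1's `world_rowP1` (BMOR18 Lemma 6.12 on `ψ_W`), `rowP2`–`rowP5`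
= the Thorner–Zaman rows of §3, `rowP6` = ls-barrier-p4's `world_rowP6` (Xylouris), `rowS5` = ⟨`world_rowS5_additive`,
`world_rowS5_theta`, `world_psi_nonneg_mono`⟩. Together with `menuConsistent_holds` (p468827) this discharges the premise of
KILL(B-dh) on `M_typed ∪ M_primes`; it is a statement about the MODEL world only. [cite: Zhang2022LandauSiegel, §2 Assumption (A)] -/
theorem menuConsistentPrimes_holds : MenuConsistentPrimes := by
  intro D _ χ _ hquad hne hL
  exact
    { rowP1 := world_rowP1 hL hquad
      rowP2 := world_rowP2 hL hquad hne
      rowP3 := world_rowP3 hL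
      rowP4 := world_rowP4 hL hquad hne
      rowP5 := world_rowP5 hL
      rowP6 := world_rowP6 χ hL
      rowS5 := ⟨world_rowS5_additive χ hne hL, world_rowS5_theta χ, world_psi_nonneg_mono hL⟩ }

/-- REF-E probe (C2): the theorem's type is LITERALLY `MenuConsistentPrimes`. [cite: Zhang2022LandauSiegel, §2 Assumption (A)] -/
example : MenuConsistentPrimes := menuConsistentPrimes_holds

/-- The two certificates of the B-dh word conjoined (`M_typed ∪ M_primes`): `MenuConsistent ∧ MenuConsistentPrimes` is stated in
the companion done-condition file (ls-barrier-p5 `Repair.doneCondition_v<k>`), which imports `DHMenuConsistentProof`; it is not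
restated here to keep this file's import cone minimal. [cite: Zhang2022LandauSiegel, §2 Assumption (A)] -/
example (h : MenuConsistent) : MenuConsistent ∧ MenuConsistentPrimes := ⟨h, menuConsistentPrimes_holds⟩

end Assembly

end Literature.NumberTheory.LFunctions.Zhang2022.DH

end
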